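import Mathlib.CategoryTheory.Adjunction.Basic
import Mathlib.CategoryTheory.Equivalence
import Mathlib.CategoryTheory.EssentialImage
import Mathlib.CategoryTheory.Endomorphism
import Mathlib.CategoryTheory.Comma.Over.Basic
import Mathlib.Algebra.Category.MonCat.Basic
import Literature.AlgebraicGeometry.Frobenioids.PadicValueMonoids
import HarnessLib

/-!
# [IUTchI] Example 3.3 (Frobenioids at good nonarchimedean primes) and the split-Frobenioid
# vocabulary of Examples 3.2–3.4 (INTERFACE)

S. Mochizuki, *Inter-universal Teichmüller theory I*, §3, Example 3.3 "Frobenioids at Good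
Nonarchimedean Primes" (i)–(iii), kurims final manuscript May 2020 pp. 77–79, and the notion of *split Frobenioid* of Example 3.2 (v) (p. 73) [claim: Mochizuki2012, status:
disputed]. DEFINITIONS only; nothing asserted. Companion: `BadLocalFrobenioid.lean` (Example 3.2).

The Example CONSTRUCTS, from a place `v ∈ V̲^good ∩ V̲^non` of the initial Θ-data, categories and
distinguished objects out of inputs ABSENT from the tree: the `p_v`-adic Frobenioids of [FrdII]
Ex. 1.1, the Galois categories `B(X̲→_v)⁰`, `B(K_v)⁰`, characteristic splittings [FrdI] Def. 2.3.
Following the cell rule ("absent deep inputs = INTERFACE structures whose axioms quote print") it is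
typed as ONE structure `GoodLocalFrobenioid p K_v` over the completed field `K_v` (a valued field;
the monoid `𝒪^▷_{K_v}` is the REAL `PadicFrd.intNonzero` of the [FrdII] Ex. 1.1 (i) file), one field
(group) per printed object, sub-item locator in every field docstring; categorical relations that
Mathlib can state ARE stated (full faithful inclusion `D⊢_v ⊆ D_v`, the left adjoint `D_v → D⊢_v`
of [FrdII] Ex. 1.3 (ii), the equivalence `C⊢_v ⥲ C^Θ_v` carrying `τ⊢_v` to `τ^Θ_v`); the claims "may
be reconstructed category-theoretically from" of Ex. 3.3 (iii) (a)–(e) are typed as `Prop`s in the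
reading fixed by Remark 3.2.1 (i) ("preserved by equivalences of categories": every
self-equivalence of the source induces a compatible one of the target, `ReconstructibleAlong`).

Deliberately NOT here: the internal definition of `p_v`-adic Frobenioids (owner abc-iut-L1-t4 —
TODO-merge; the `S3Local` stub of a characteristic splitting records only its shape); Rmk 3.3.1
(terminology); Rmk 3.3.2 ("`C_v` (resp. `C⊢_v`) consists of essentially the same data as an
MLF-Galois TM-pair of strictly Belyi type (resp. of mono-analytic type)", [AbsTopIII] Def. 3.1 (ii))
— recorded only, TODO-merge:abc-iut-L4-t2 [AbsTopIII] Def. 3.1; the divisor-monoid scalars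
(`GlobalRealifiedFrobenioids.lean`).
-/

namespace Literature.IUT.HodgeTheaters

open CategoryTheory Literature.AlgebraicGeometry.Frobenioids

universe u


/-! ### Local stubs (TODO-merge) -/

namespace S3Local

/-- TODO-merge:abc-iut-L1-t2 [FrdI] Def. 2.3 — a *characteristic splitting* on (a category
underlying) a Frobenioid: for every object `A` a submonoid `τ_A ⊆ End(A)` (in print: of
`𝒪^▷(A)`, splitting the divisor map); only the shape is recorded here.
[claim: Mochizuki2012, status: disputed] -/
structure CharSplitting (C : Type u) [Category.{u} C] where
  /-- `A ↦ τ_A ⊆ End(A)` -/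
  sect : ∀ A : C, Submonoid (End A)

/-- Transport of a characteristic splitting along an equivalence (used to say "maps `τ⊢_v` to
`τ^Θ_v`", Ex. 3.2 (v)). [claim: Mochizuki2012, status: disputed] -/
def CharSplitting.IsPreservedBy {C : Type u} [Category.{u} C] {C' : Type u} [Category.{u} C']
    (τ : CharSplitting C) (τ' : CharSplitting C') (Φ : C ⥤ C') : Prop :=
  ∀ A : C, (τ.sect A).map (Φ.mapEnd A) = τ'.sect (Φ.obj A)

end S3Local

/-- A *split Frobenioid*: "a pair … consisting of a Frobenioid equipped with a collection of
characteristic splittings" (Ex. 3.2 (v), p. 73: `F⊢_v := (C⊢_v, τ⊢_v)`, `F^Θ_v := (C^Θ_v, τ^Θ_v)`);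
the Frobenioid structure of the category is interface. [claim: Mochizuki2012, status: disputed] -/
structure SplitFrobenioid where
  /-- the underlying category of the Frobenioid -/
  Cat : Type u
  /-- its category structure -/
  [inst : Category.{u} Cat]
  /-- the characteristic splitting -/
  tau : S3Local.CharSplitting Cat

attribute [instance] SplitFrobenioid.inst

/-- "Reconstructed category-theoretically from", in the reading of Remark 3.2.1 (i) ("preserved by
equivalences of categories"), for a structure functor `Φ : T ⥤ S` exhibiting the target `T` over the
source `S`: every self-equivalence of `S` lifts, compatibly, to a self-equivalence of `T`.
[claim: Mochizuki2012, status: disputed] -/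
def ReconstructibleAlong {S : Type u} [Category.{u} S] {T : Type u} [Category.{u} T] (Φ : T ⥤ S) :
    Prop :=
  ∀ e : S ≌ S, ∃ e' : T ≌ T, Nonempty (Φ ⋙ e.functor ≅ e'.functor ⋙ Φ)

/-! ### Example 3.3: `v ∈ V̲^good ∩ V̲^non` -/

/-- **[IUTchI] Example 3.3** (Frobenioids at good nonarchimedean primes), pp. 77–79, for a place
`v ∈ V̲^good ∩ V̲^non` with completed base field `K_v` of residue characteristic `p`: the data
(i)–(ii) as an INTERFACE. [claim: Mochizuki2012, status: disputed] -/
structure GoodLocalFrobenioid (p : ℕ) (Kv : Type) [Field Kv] [ValuativeRel Kv] where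
  /-- (i) `D_v := B(X̲→_v)⁰` (TODO-merge:abc-iut-L5-t1 `X̲→`, abc-iut-L3-t1 Galois categories) -/
  Dv : Type u
  /-- category structure on `D_v` -/
  [instDv : Category.{u} Dv]
  /-- (i) `D⊢_v := B(K_v)⁰` -/
  Ddash : Type u
  /-- category structure on `D⊢_v` -/
  [instDdash : Category.{u} Ddash]
  /-- (i) "`D⊢_v` may be naturally regarded … as a full subcategory `D⊢_v ⊆ D_v`": the inclusion … -/
  incl : Ddash ⥤ Dv
  /-- … is full … -/
  [incl_full : incl.Full]
  /-- … and faithful -/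
  [incl_faithful : incl.Faithful]
  /-- (i) "a natural functor `D_v → D⊢_v`, which is left-adjoint to the natural inclusion functor"
  ([FrdII] Ex. 1.3 (ii)) -/
  proj : Dv ⥤ Ddash
  /-- the adjunction `proj ⊣ incl` -/
  adj : proj ⊣ incl
  /-- (i) the monoid `Φ_{C_v}` on `D⊢_v` (hence, by pull-back via `proj`, on `D_v`),
  "`Spec(L) ↦ ord(𝒪^▷_L)^pf`" ([FrdII] Ex. 1.1 (i); `ord(𝒪^▷) = PadicFrd.OrdInt`, perfection
  [FrdI] §0) -/
  PhiC : Ddashᵒᵖ ⥤ CommMonCat.{u}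
  /-- (i) "`Φ_{C⊢_v} : Spec(L) ↦ ord(ℤ^▷_{p_v}) (⊆ ord(𝒪^▷_L)^pf)` … an absolutely primitive submonoid
  `Φ_{C⊢_v} ⊆ Φ_{C_v}|_{D⊢_v}`" — as a subfunctor … -/
  PhiCdash : Ddashᵒᵖ ⥤ CommMonCat.{u}
  /-- … with its inclusion -/
  PhiIncl : PhiCdash ⟶ PhiC
  /-- the inclusion is objectwise injective -/
  PhiIncl_injective : ∀ A, Function.Injective (PhiIncl.app A)
  /-- `ord(ℤ^▷_{p_v}) ≅ ℕ`, generated by `p_v`: each `Φ_{C⊢_v}(A)` is free on one generator `log(p_v)` -/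
  logp : ∀ A, PhiCdash.obj A
  /-- `log(p_v)` generates -/
  logp_generates : ∀ A (x : PhiCdash.obj A), ∃! n : ℕ, x = (logp A) ^ n
  /-- (i) "these monoids `Φ_{C⊢_v}`, `Φ_{C_v}` determine `p_v`-adic Frobenioids `C⊢_v ⊆ C_v`" ([FrdII]
  Ex. 1.1 (ii), "`Λ = ℤ`"; TODO-merge:abc-iut-L1-t4): `C_v` … -/
  Cv : Type u
  /-- category structure on `C_v` -/
  [instCv : Category.{u} Cv]
  /-- … over `D_v` ("`F̲_v := C_v`") -/
  toBase : Cv ⥤ Dv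
  /-- `C⊢_v` … -/
  Cdash : Type u
  /-- category structure on `C⊢_v` -/
  [instCdash : Category.{u} Cdash]
  /-- … over `D⊢_v` … -/
  CdashBase : Cdash ⥤ Ddash
  /-- … with `C⊢_v ⊆ C_v`, a subcategory (faithful inclusion; not asserted full: the divisor monoid
  `Φ_{C⊢_v}` is a proper submonoid of `Φ_{C_v}|_{D⊢_v}`, [FrdII] Ex. 1.1 (ii)) … -/
  CdashToC : Cdash ⥤ Cv
  /-- … the inclusion is faithful … -/
  [CdashToC_faithful : CdashToC.Faithful]
  /-- … "in a fashion compatible with the natural inclusion `D⊢_v ⊆ D_v`" -/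
  CdashToC_base : Nonempty (CdashToC ⋙ toBase ≅ CdashBase ⋙ incl)
  /-- (i) `p_v ∈ ℤ^▷_{p_v} ⊆ 𝒪^▷_{K_v}` (REAL: the image of the prime `p` in the valued field `K_v`) -/
  p_mem : ((p : Kv)) ∈ PadicFrd.intNonzero Kv
  /-- (i) `τ⊢_v`, the characteristic splitting on `C⊢_v` determined by `p_v` ([FrdII] Thm. 1.2 (v)) -/
  tauDash : S3Local.CharSplitting Cdash
  /-- (ii) `C^Θ_v`, "some `p_v`-adic Frobenioid with base category `D^Θ_v := D⊢_v`" whose monoid is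
  `𝒪^▷_{C^Θ_v}(−) := 𝒪^×_{C⊢_v}(−) × (ℕ·log(p_v)·log(Θ))`, "naturally isomorphic to `𝒪^▷_{C⊢_v}`" … -/
  CTheta : Type u
  /-- category structure on `C^Θ_v` -/
  [instCTheta : Category.{u} CTheta]
  /-- … over `D^Θ_v := D⊢_v` -/
  CThetaBase : CTheta ⥤ Ddash
  /-- (ii) `τ^Θ_v`, "a characteristic splitting determined by `log(p_v)·log(Θ)`" -/
  tauTheta : S3Local.CharSplitting CTheta
  /-- (ii) "we have a natural equivalence `F⊢_v ⥲ F^Θ_v`" … -/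
  dashThetaEquiv : Cdash ≌ CTheta
  /-- … of split Frobenioids (the splitting is carried along) … -/
  dashThetaEquiv_tau : tauDash.IsPreservedBy tauTheta dashThetaEquiv.functor
  /-- … over the identity of `D⊢_v = D^Θ_v` -/
  dashThetaEquiv_base : Nonempty (CdashBase ≅ dashThetaEquiv.functor ⋙ CThetaBase)

attribute [instance] GoodLocalFrobenioid.instDv GoodLocalFrobenioid.instDdash
  GoodLocalFrobenioid.incl_full GoodLocalFrobenioid.incl_faithful GoodLocalFrobenioid.instCv
  GoodLocalFrobenioid.instCdash GoodLocalFrobenioid.CdashToC_faithful GoodLocalFrobenioid.instCTheta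

namespace GoodLocalFrobenioid

variable {p : ℕ} {Kv : Type} [Field Kv] [ValuativeRel Kv]

/-- `F̲_v := C_v` (Ex. 3.3 (i)). [claim: Mochizuki2012, status: disputed] -/
abbrev Fv (G : GoodLocalFrobenioid.{u} p Kv) : Type u := G.Cv

/-- `F⊢_v := (C⊢_v, τ⊢_v)` (Ex. 3.3 (i)). [claim: Mochizuki2012, status: disputed] -/
def Fdash (G : GoodLocalFrobenioid.{u} p Kv) : SplitFrobenioid.{u} := ⟨G.Cdash, G.tauDash⟩

/-- `F^Θ_v := (C^Θ_v, τ^Θ_v)` (Ex. 3.3 (ii)). [claim: Mochizuki2012, status: disputed] -/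
def Ftheta (G : GoodLocalFrobenioid.{u} p Kv) : SplitFrobenioid.{u} := ⟨G.CTheta, G.tauTheta⟩

/-- `p_v` as an element of `𝒪^▷_{K_v}` (Ex. 3.3 (i)). [claim: Mochizuki2012, status: disputed] -/
def pElt (G : GoodLocalFrobenioid.{u} p Kv) : PadicFrd.intNonzero Kv := ⟨(p : Kv), G.p_mem⟩

/-- Ex. 3.3 (iii) (a): "`D⊢_v ⊆ D_v` may be reconstructed category-theoretically from `D_v`"
([AbsAnab] Lemma 1.3.8) — typed as a statement. [claim: Mochizuki2012, status: disputed] -/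
def DdashFromD (G : GoodLocalFrobenioid.{u} p Kv) : Prop := ReconstructibleAlong G.incl

/-- Ex. 3.3 (iii) (b): "`D⊢_v` (respectively, `D^Θ_v`) may be reconstructed category-theoretically
from `C⊢_v` (respectively, `C^Θ_v`)" — typed as a statement. [claim: Mochizuki2012, status: disputed] -/
def BasesFromC (G : GoodLocalFrobenioid.{u} p Kv) : Prop :=
  (∀ e : G.Cdash ≌ G.Cdash, ∃ e' : G.Ddash ≌ G.Ddash,
      Nonempty (G.CdashBase ⋙ e'.functor ≅ e.functor ⋙ G.CdashBase)) ∧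
    ∀ e : G.CTheta ≌ G.CTheta, ∃ e' : G.Ddash ≌ G.Ddash,
      Nonempty (G.CThetaBase ⋙ e'.functor ≅ e.functor ⋙ G.CThetaBase)

/-- Ex. 3.3 (iii) (c): "`D_v` may be reconstructed category-theoretically from `F̲_v = C_v`" —
typed as a statement. [claim: Mochizuki2012, status: disputed] -/
def DFromF (G : GoodLocalFrobenioid.{u} p Kv) : Prop :=
  ∀ e : G.Cv ≌ G.Cv, ∃ e' : G.Dv ≌ G.Dv, Nonempty (G.toBase ⋙ e'.functor ≅ e.functor ⋙ G.toBase)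

/-- Ex. 3.3 (iii) (d): "`C⊢_v` may be reconstructed category-theoretically from `F̲_v`" (by the
category-theoreticity of `Φ_{C_v}`, [FrdI] Cor. 4.11 (iii)) — typed as a statement.
[claim: Mochizuki2012, status: disputed] -/
def CdashFromF (G : GoodLocalFrobenioid.{u} p Kv) : Prop := ReconstructibleAlong G.CdashToC

/-- Ex. 3.3 (iii) (e): "one may reconstruct the split Frobenioids `F⊢_v`, `F^Θ_v`
category-theoretically from `F̲_v`" (the element `p_v`, hence `τ⊢_v`, via the Kummer map of
[AbsTopIII] Prop. 3.2 (iii); `X_F` "of strictly Belyi type") — typed as a statement: a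
self-equivalence of `F̲_v = C_v` induces one of `C⊢_v` preserving `τ⊢_v` AND, through
`F⊢_v ⥲ F^Θ_v`, one of `C^Θ_v` preserving `τ^Θ_v`. [claim: Mochizuki2012, status: disputed] -/
def SplitFromF (G : GoodLocalFrobenioid.{u} p Kv) : Prop :=
  ∀ e : G.Cv ≌ G.Cv, ∃ e' : G.Cdash ≌ G.Cdash, ∃ e'' : G.CTheta ≌ G.CTheta,
    Nonempty (G.CdashToC ⋙ e.functor ≅ e'.functor ⋙ G.CdashToC) ∧
      G.tauDash.IsPreservedBy G.tauDash e'.functor ∧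
        Nonempty (G.dashThetaEquiv.functor ⋙ e''.functor ≅ e'.functor ⋙ G.dashThetaEquiv.functor) ∧
          G.tauTheta.IsPreservedBy G.tauTheta e''.functor

end GoodLocalFrobenioid

end Literature.IUT.HodgeTheaters
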